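import Summits.Parity.GeneralizedHardyLittlewood.Theorems.GoldbachHeathBrownDispersionHeathBrownMorozUniformOfClassLemmas
import Literature.NumberTheory.Sieve.HeathBrownMorozClassLemma35
import HarnessLib

/-!
# Crux `HeathBrownMorozUniform` (stmt-Parity-19915) from TWO class lemmas (leading parts, Type II)

Helper (`--supports stmt-Parity-19915`) of the coset port of Heath-Brown 2001 to the residue classes
of Heath-Brown–Moroz 2004: the first of the three class hypotheses of
`heathBrownMorozUniform_of_classLemmas` (`h35`, the class Fundamental-Lemma comparison = HBM Lemma
3.1) is now a theorem of the tree — `Literature.NumberTheory.Sieve.CubicSieve.class_lemma_3_5`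
(`HeathBrownMorozClassLemma35`, built on the unconditional class Type-I estimate `class_typeI_A`,
the class level of distribution `class_level`, and the class port of §6 of the 2001 paper).  Hence
the crux follows from the remaining two: `h39` (class leading parts, HB Lemma 3.9 / HBM Lemma 4.1)
and `h310` (class Type II, HB Lemma 3.10 / HBM Prop. 4.2 (ii)).
[cite: HeathBrownMoroz2004, Lemma 3.1 and Theorem 2] [cite: HeathBrownActa2001, Lemma 3.5]
-/

noncomputable section

open Polynomial NumberField Finset Filter Topology Asymptotics

namespace Summit.Parity.GeneralizedHardyLittlewood.Theorems.GoldbachHeathBrownDispersionHeathBrownMorozUniform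

open Literature.NumberTheory.Sieve.CubicSieve Literature.NumberTheory.Sieve.CubicPrimes
open Literature.NumberTheory.LFunctions.CubeRootTwoField

/-- **The crux `HeathBrownMorozUniform` from the class leading-parts lemma and the class Type-II
lemma** (the class FL comparison `h35` being the theorem `class_lemma_3_5`).
[cite: HeathBrownMoroz2004, Theorem 2] [cite: HeathBrownActa2001, Lemmas 3.5, 3.9, 3.10] -/
theorem heathBrownMorozUniform_of_twoClassLemmas
    (h39 : ∀ d a b : ℕ, 0 < d → a < d → b < d → Nat.Coprime (a ^ 3 + 2 * b ^ 3) d →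
      ∀ σ₀ : ℝ, Tendsto singularProductPartial atTop (𝓝 σ₀) → ∀ ϖ : ℝ, 0 < ϖ → ϖ < 1 / 5 →
        ∃ c C X₀ : ℝ, ∀ X η : ℝ, X₀ ≤ X → Real.exp (-Real.log X ^ (1 / 3 : ℝ)) ≤ η → η ≤ 1 →
          ∀ (k : ℕ) (m : Fin k → ℕ), CoreAdmissible (hbTau ϖ X) m →
            ∀ cR : Ideal (𝓞 K) → ℝ, CSupport X (hbTau ϖ X) cR →
              |bilin (classPairs X η d a b) pairIdeal cR (eWeight X (hbTau ϖ X) m) -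
                  classKappa σ₀ X η d *
                    bilin (normWindow X η) (fun J => J) cR (dWeight X (hbTau ϖ X) m)| ≤
                C * (∏ i, (m i : ℝ))⁻¹ * η ^ (5 / 2 : ℝ) * X ^ 2 * Real.log X ^ c)
    (h310 : ∀ d a b : ℕ, 0 < d → a < d → b < d → Nat.Coprime (a ^ 3 + 2 * b ^ 3) d →
      ∀ ϖ : ℝ, 0 < ϖ → ϖ < 1 / 5 →
        ∃ c c₃ c₄ : ℝ, 0 < c₃ ∧ 0 < c₄ ∧ ∀ C₁ c₁ c₅ c₆ : ℝ, 0 < c₁ → 0 < c₅ → 0 < c₆ →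
          ∃ C X₀ : ℝ, ∀ X η Q₁ : ℝ, X₀ ≤ X → Real.exp (-Real.log X ^ (1 / 3 : ℝ)) ≤ η → η ≤ 1 →
            1 ≤ Q₁ → (d : ℝ) * Q₁ ≤ Real.exp (Real.log X ^ (1 / 3 : ℝ)) →
              (∀ (k' : ℕ) (m' : Fin k' → ℕ), CoreAdmissible (hbTau ϖ X) m' →
                Hyp314 X (hbTau ϖ X) m' ((d : ℝ) * Q₁) C₁ c₁ c₃ c₄) →
                ∀ (k : ℕ) (m : Fin k → ℕ), CoreAdmissible (hbTau ϖ X) m →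
                  ∀ cR : Ideal (𝓞 K) → ℝ, CSupport X (hbTau ϖ X) cR →
                    ∀ V : ℝ, c₅ * X ^ (1 + hbTau ϖ X) ≤ V → V ≤ c₆ * X ^ (3 / 2 - hbTau ϖ X) →
                      |bilin (classPairs X η d a b) pairIdeal cR
                          (fun S => if V < (Ideal.absNorm S : ℝ) ∧ (Ideal.absNorm S : ℝ) ≤ 2 * V then
                            fWeight X (hbTau ϖ X) m S else 0)| ≤
                        C * X ^ 2 * Q₁ ^ (-(1 / 160 : ℝ)) * Real.log X ^ c) :
    Summit.Parity.GeneralizedHardyLittlewood.Theses.GoldbachHeathBrownDispersion.HeathBrownMorozUniform :=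
  heathBrownMorozUniform_of_classLemmas
    (fun _ _ _ hd ha hb hadm σ₀ hσ ϖ hϖ0 hϖ5 => class_lemma_3_5 hd ha hb hadm σ₀ hσ ϖ hϖ0 hϖ5) h39 h310

end Summit.Parity.GeneralizedHardyLittlewood.Theorems.GoldbachHeathBrownDispersionHeathBrownMorozUniform

end
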